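import Literature.Topology.CoveringSpaces.CoveringGaloisCorrespondence
import Mathlib.CategoryTheory.Endomorphism
import HarnessLib

/-!
# The Galois correspondence for FINITE covering spaces: the fibre functor
# `Cov^fin(X) ⥤ (finite π₁(X, x₀)-sets)` is fully faithful

Topic `Literature/Topology/CoveringSpaces` — step (D), finite form, of the topological Galois
correspondence (abc-iut cell, campaign-L R1, GAP row G-L4t14-R1; the shape named in the cell's
MEMO-geometric-EA-residual §2 item 1: «Cov^fin(X) ≌ FinSet^{π₁(X,x)}»).  Sequel of
`CoveringGaloisCorrespondence.lean` (`Cov X`, `Cov.fibreFunctor`):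

* `IsFiniteCovering`, `CovFin X` — the full subcategory of `Over (TopCat.of X)` on the covering
  maps ALL of whose fibres are finite (for a connected base one finite fibre suffices, by the
  tree's `finite_preimage_singleton_of_preconnectedSpace`; we keep the base-point-free property);
  `CovFin.toCov : CovFin X ⥤ Cov X` (Mathlib `ObjectProperty.ιOfLE`);
* `CovFin.fibreFunctor x₀ : CovFin X ⥤ Action FintypeCat (FundamentalGroup X x₀)` — the finite
  fibre over `x₀` with its monodromy action (Mathlib's `FintypeCat` = full subcategory of `Type`
  on `Finite`, `Action.FintypeCat.ofMulAction`);
* `CovFin.fibreFunctor_faithful`, `CovFin.fibreFunctor_full`, `CovFin.fullyFaithfulFibreFunctor` —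
  **fully faithful for `X` path connected and locally path connected** (same proof as for `Cov X`,
  from (A)'s `CoverMorphism.eq_of_fibreMap_eq` / `liftOfEquivariant`);
* `CovFin.iso_of_fibre_iso`, `CovFin.nonempty_iso_iff` — finite covers are isomorphic iff their
  fibres are isomorphic finite `π₁(X, x₀)`-sets;
* `CovFin.autMulEquiv E : Aut E ≃* Aut ((fibreFunctor x₀).obj E)` — the automorphism group of a
  finite cover (its deck transformation group) is the group of equivariant permutations of the
  fibre (Mathlib `autMulEquivOfFullyFaithful`).

`Action FintypeCat G` is the Galois category of Mathlib's `CategoryTheory.Galois.Examples`; the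
equivalence (essential surjectivity, for `X` moreover semilocally simply connected) is added with
step (C).  No instances declared; no named facts.

## References

* A. Hatcher, *Algebraic Topology*, CUP 2002, §1.3 Thm. 1.38, pp. 68–70 («n-sheeted covering
  spaces … homomorphisms π₁(X,x₀) → Σₙ»). [HatcherAT2002]
* A. Grothendieck, M. Raynaud, SGA 1, Exp. V §4–§5.
-/

noncomputable section

open CategoryTheory Function Set

universe u

namespace Literature.Topology.CoveringSpaces

variable (X : Type u) [TopologicalSpace X]

/-- The property «the structure map is a covering map with finite fibres» on spaces over `X`.
[cite: HatcherAT2002, §1.3 p.56 (number of sheets)] -/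
def IsFiniteCovering : ObjectProperty (Over (TopCat.of X)) :=
  fun E ↦ IsCoveringMap (E.hom : E.left → X) ∧ ∀ x : X, Finite ((E.hom : E.left → X) ⁻¹' {x})

/-- A finite covering is a covering. [cite: HatcherAT2002, §1.3 p.56] -/
theorem isFiniteCovering_le_isCovering : IsFiniteCovering X ≤ IsCovering X := fun _ h ↦ h.1

/-- **The category `Cov^fin(X)` of finite covering spaces of `X`** (covering maps with finite
fibres, continuous maps over `X`). [cite: HatcherAT2002, §1.3 p.56, p.67] -/
abbrev CovFin : Type (u + 1) := (IsFiniteCovering X).FullSubcategory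

namespace CovFin

variable {X}

/-- The projection of a finite covering space. [cite: HatcherAT2002, §1.3 p.56] -/
abbrev proj (E : CovFin X) : E.obj.left → X := E.obj.hom

/-- The projection is a covering map. [cite: HatcherAT2002, §1.3 p.56] -/
theorem isCoveringMap_proj (E : CovFin X) : IsCoveringMap E.proj := E.property.1

/-- The fibres are finite. [cite: HatcherAT2002, §1.3 p.56] -/
theorem finite_fibre (E : CovFin X) (x : X) : Finite (E.proj ⁻¹' {x}) := E.property.2 x

/-- Constructor: a covering map with finite fibres as an object of `Cov^fin(X)`.
[cite: HatcherAT2002, §1.3 p.56] -/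
def mk {E : Type u} [TopologicalSpace E] (p : E → X) (hp : IsCoveringMap p)
    (hfin : ∀ x, Finite (p ⁻¹' {x})) : CovFin X :=
  ⟨Over.mk (Y := TopCat.of E) (TopCat.ofHom ⟨p, hp.continuous⟩), hp, hfin⟩

/-- The projection of `CovFin.mk p hp hfin` is `p`. [cite: HatcherAT2002, §1.3 p.56] -/
@[simp] theorem proj_mk {E : Type u} [TopologicalSpace E] (p : E → X) (hp : IsCoveringMap p)
    (hfin : ∀ x, Finite (p ⁻¹' {x})) : (mk p hp hfin).proj = p := rfl

/-- The inclusion `Cov^fin(X) ⥤ Cov(X)` (fully faithful, Mathlib `ObjectProperty.ιOfLE`).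
[cite: HatcherAT2002, §1.3 p.67] -/
abbrev toCov : CovFin X ⥤ Cov X := ObjectProperty.ιOfLE (isFiniteCovering_le_isCovering X)

/-- A morphism of `Cov^fin(X)` lies over `X`. [cite: HatcherAT2002, §1.3 p.67] -/
theorem hom_over {E F : CovFin X} (f : E ⟶ F) (e : E.obj.left) : F.proj (f.hom.left e) = E.proj e :=
  Cov.hom_over (toCov.map f) e

/-- A morphism of `Cov^fin(X)` is continuous. [cite: HatcherAT2002, §1.3 p.67] -/
theorem continuous_hom {E F : CovFin X} (f : E ⟶ F) :
    Continuous (f.hom.left : E.obj.left → F.obj.left) :=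
  f.hom.left.hom.continuous

/-- Constructor for morphisms of `Cov^fin(X)`: a continuous map over `X`.
[cite: HatcherAT2002, §1.3 p.67] -/
def homMk {E F : CovFin X} (g : E.obj.left → F.obj.left) (hg : Continuous g)
    (h : ∀ e, F.proj (g e) = E.proj e) : E ⟶ F :=
  ObjectProperty.homMk (Over.homMk (TopCat.ofHom ⟨g, hg⟩) (by ext e; exact h e))

/-- The underlying map of `homMk g _ _` is `g`. [cite: HatcherAT2002, §1.3 p.67] -/
@[simp] theorem homMk_apply {E F : CovFin X} (g : E.obj.left → F.obj.left) (hg : Continuous g)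
    (h : ∀ e, F.proj (g e) = E.proj e) (e : E.obj.left) : (homMk g hg h).hom.left e = g e := rfl

/-- Two morphisms of `Cov^fin(X)` with the same underlying map are equal.
[cite: HatcherAT2002, §1.3 p.67] -/
theorem hom_ext {E F : CovFin X} {f g : E ⟶ F}
    (h : (f.hom.left : E.obj.left → F.obj.left) = g.hom.left) : f = g := by
  apply ObjectProperty.hom_ext
  ext e
  exact congrFun h e

/-! ### The finite fibre functor -/

variable (x₀ : X)

/-- **The finite fibre functor** `Cov^fin(X) ⥤ (finite π₁(X, x₀)-sets)` = `Action FintypeCat π₁`: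
the finite fibre over `x₀` with the monodromy action; morphisms go to their (equivariant) fibre
maps. [cite: HatcherAT2002, §1.3 pp.68–70] -/
def fibreFunctor : CovFin X ⥤ Action FintypeCat.{u} (FundamentalGroup X x₀) where
  obj E :=
    letI := E.property.1.fundamentalGroupMulAction x₀
    haveI : Finite (E.proj ⁻¹' {x₀}) := E.property.2 x₀
    Action.FintypeCat.ofMulAction (FundamentalGroup X x₀) (FintypeCat.of (E.proj ⁻¹' {x₀}))
  map {E F} f :=
    { hom := FintypeCat.homMk (CoverMorphism.fibreMap (p₁ := E.proj) (p₂ := F.proj)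
        (f.hom.left : E.obj.left → F.obj.left) (hom_over f) x₀)
      comm := fun γ ↦ by
        ext e
        change CoverMorphism.fibreMap _ (hom_over f) x₀ (E.property.1.monodromy γ e) =
          F.property.1.monodromy γ (CoverMorphism.fibreMap _ (hom_over f) x₀ e)
        exact (CoverMorphism.monodromy_fibreMap E.property.1 F.property.1 (continuous_hom f)
          (hom_over f) γ e).symm }
  map_id E := by
    refine Action.Hom.ext ?_
    ext e
    rfl
  map_comp f g := by
    refine Action.Hom.ext ?_
    ext e
    rfl

/-- The carrier of the finite fibre `π₁`-set of `E` is the fibre `p⁻¹(x₀)`. [cite: HatcherAT2002, §1.3 p.68] -/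
theorem fibreFunctor_obj_V (E : CovFin X) :
    (((fibreFunctor x₀).obj E).V : Type u) = (E.proj ⁻¹' {x₀}) := rfl

/-- The action on the finite fibre is the monodromy. [cite: HatcherAT2002, §1.3 p.69] -/
theorem fibreFunctor_obj_ρ_apply (E : CovFin X) (γ : FundamentalGroup X x₀) (e : E.proj ⁻¹' {x₀}) :
    (((fibreFunctor x₀).obj E).ρ γ).hom e = E.property.1.monodromy γ e := rfl

/-- On morphisms the finite fibre functor is the fibre map. [cite: HatcherAT2002, §1.3 p.69] -/
theorem fibreFunctor_map_apply {E F : CovFin X} (f : E ⟶ F) (e : E.proj ⁻¹' {x₀}) :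
    ((fibreFunctor x₀).map f).hom e =
      CoverMorphism.fibreMap (f.hom.left : E.obj.left → F.obj.left) (hom_over f) x₀ e := rfl

/-- A morphism of finite fibre `π₁`-sets commutes with the monodromy, pointwise.
[cite: HatcherAT2002, §1.3 p.69] -/
theorem hom_semiconj {E F : CovFin X} (φ : (fibreFunctor x₀).obj E ⟶ (fibreFunctor x₀).obj F)
    (γ : Path.Homotopic.Quotient x₀ x₀) :
    Semiconj (fun e ↦ φ.hom e) (E.property.1.monodromy γ) (F.property.1.monodromy γ) :=
  fun e ↦ ConcreteCategory.congr_hom (φ.comm γ) e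

/-! ### Full faithfulness -/

variable [PathConnectedSpace X]

/-- **The finite fibre functor is faithful** (Hatcher Prop. 1.34). [cite: HatcherAT2002, §1.3 Prop. 1.34] -/
theorem fibreFunctor_faithful : (fibreFunctor (X := X) x₀).Faithful := by
  refine ⟨fun {E F} f g h ↦ hom_ext ?_⟩
  refine CoverMorphism.eq_of_fibreMap_eq (p₁ := E.proj) (p₂ := F.proj) E.property.1 F.property.1
    (continuous_hom f) (continuous_hom g) (hom_over f) (hom_over g) x₀ ?_
  funext e
  exact congrArg (fun k : (fibreFunctor x₀).obj E ⟶ (fibreFunctor x₀).obj F ↦ k.hom e) h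

variable [LocallyPathConnectedSpace X]

/-- The morphism of finite covers with a prescribed equivariant fibre map (Hatcher Prop. 1.33,
via (A)'s `CoverMorphism.liftOfEquivariant`). [cite: HatcherAT2002, §1.3 Prop. 1.33] -/
def preimageHom {E F : CovFin X} (φ : (fibreFunctor x₀).obj E ⟶ (fibreFunctor x₀).obj F) : E ⟶ F :=
  homMk
    (CoverMorphism.liftOfEquivariant (p₁ := E.proj) (p₂ := F.proj) E.property.1 F.property.1
      (x₀ := x₀) (fun e ↦ φ.hom e))
    (CoverMorphism.continuous_liftOfEquivariant (hom_semiconj x₀ φ))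
    (fun e ↦ CoverMorphism.liftOfEquivariant_spec e)

/-- The fibre map of `preimageHom φ` is `φ`. [cite: HatcherAT2002, §1.3 Prop. 1.33] -/
theorem fibreFunctor_map_preimageHom {E F : CovFin X}
    (φ : (fibreFunctor x₀).obj E ⟶ (fibreFunctor x₀).obj F) :
    (fibreFunctor x₀).map (preimageHom x₀ φ) = φ := by
  refine Action.Hom.ext ?_
  ext e
  apply Subtype.ext
  exact CoverMorphism.liftOfEquivariant_apply_fibre (hom_semiconj x₀ φ) e

/-- **The finite fibre functor is full** (Hatcher Prop. 1.33 / Thm. 1.38).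
[cite: HatcherAT2002, §1.3 Prop. 1.33, Thm. 1.38] -/
theorem fibreFunctor_full : (fibreFunctor (X := X) x₀).Full :=
  ⟨fun φ ↦ ⟨preimageHom x₀ φ, fibreFunctor_map_preimageHom x₀ φ⟩⟩

/-- **THE FINITE FIBRE FUNCTOR `Cov^fin(X) ⥤ Action FintypeCat π₁(X, x₀)` IS FULLY FAITHFUL** for `X`
path connected and locally path connected (Hatcher Thm. 1.38, morphism form, n-sheeted covers).
[cite: HatcherAT2002, §1.3 Thm. 1.38] -/
def fullyFaithfulFibreFunctor : (fibreFunctor (X := X) x₀).FullyFaithful where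
  preimage φ := preimageHom x₀ φ
  map_preimage φ := fibreFunctor_map_preimageHom x₀ φ
  preimage_map _ := (fibreFunctor_faithful x₀).map_injective (fibreFunctor_map_preimageHom x₀ _)

/-- Finite covers with isomorphic fibre `π₁`-sets are isomorphic over `X`.
[cite: HatcherAT2002, §1.3 Thm. 1.38] -/
def iso_of_fibre_iso {E F : CovFin X} (φ : (fibreFunctor x₀).obj E ≅ (fibreFunctor x₀).obj F) :
    E ≅ F :=
  (fullyFaithfulFibreFunctor x₀).preimageIso φ

/-- `E ≅ F` in `Cov^fin(X)` iff the fibres are isomorphic finite `π₁(X, x₀)`-sets (Hatcher Thm. 1.38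
for n-sheeted covers: isomorphism classes ↔ conjugacy classes of `π₁(X,x₀) → Σₙ`).
[cite: HatcherAT2002, §1.3 Thm. 1.38, p.70] -/
theorem nonempty_iso_iff {E F : CovFin X} :
    Nonempty (E ≅ F) ↔ Nonempty ((fibreFunctor x₀).obj E ≅ (fibreFunctor x₀).obj F) :=
  ⟨fun ⟨i⟩ ↦ ⟨(fibreFunctor x₀).mapIso i⟩, fun ⟨φ⟩ ↦ ⟨iso_of_fibre_iso x₀ φ⟩⟩

/-- **The automorphism group of a finite cover (its group of deck transformations, as
automorphisms in `Cov^fin(X)`) is the group of `π₁(X, x₀)`-equivariant permutations of its fibre.**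
[cite: HatcherAT2002, §1.3 Prop. 1.39, p.70] -/
def autMulEquiv (E : CovFin X) : Aut E ≃* Aut ((fibreFunctor x₀).obj E) :=
  (fullyFaithfulFibreFunctor x₀).autMulEquivOfFullyFaithful E

end CovFin

end Literature.Topology.CoveringSpaces

end
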